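import Summits.AtomisticToContinuum.FouriersLaw.Theorems.VanishingNoiseTransferNoisyFourierAbelTimeProfileAux1
import Summits.AtomisticToContinuum.FouriersLaw.Theorems.VanishingNoiseTransferVanishingNoiseBoundFlipSemigroup
import Summits.AtomisticToContinuum.FouriersLaw.Theorems.BondHeatUncertaintySubdiffusiveBondHeatKernelGibbsD

/-!
# The flip semigroup of the pinned chain at equilibrium: Gibbs invariance and the Laplace–Neumann identity
(`--supports stmt-AtomisticToContinuum-11977` helper file, crux `VanishingNoiseTransfer.NoisyFourier`, line
`abel-storage-decay`, registered stub `stub_timeProfileMatching`, half T1 = the fixed-`L` time-profile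
representation of the Abel pairing; worker T1 of lead c6, part 2 of 4)

`VanishingNoiseBound.exists_flipSemigroup` (…VanishingNoiseBoundFlipSemigroup) delivers the transition semigroup
`V_t` of the velocity-flip dynamics `L + εS` of the pinned anharmonic chain EXISTENTIALLY (Markov, `V_0 = id`,
Chapman–Kolmogorov, joint measurability, domination by the flip-free kernels, resolvent identity on `C_c^∞`), as
the Dyson–Phillips jump perturbation of the flip-free semigroup by the uniform flip kernel `Q = flipKernel N` at
rate `Nε`. Two further properties of that construction are established inside its proof or one induction away
from it, but not exported; the time-profile representation of the Abel–Green–Kubo pairing needs both. This file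
re-runs the construction (verbatim, cited) at equal bath temperatures `T_L = T_R = T > 0` and exposes them
(`exists_flipSemigroup_gibbs`):

* (Inv) `μ_T V_t = μ_T`: the Gibbs measure `gibbsMeasure N T` is invariant (it is invariant under the flip-free
  kernels, `pinnedChain_gibbsMeasure_bind_transitionKernel`, and under `Q`, `measurePreserving_momentumFlip_gibbsMeasure`;
  part 1, `JumpPerturbation.bind_V_of_invariant`);
* (Lap) the LAPLACE–NEUMANN IDENTITY for every measurable `φ ≥ 0`, every `a > 0` and every state `z`:
  `∫ Exp_a(dt) ∫ φ dV_t(z, ·) = ∑_n (a/(a+Nε)) (Nε/(a+Nε))^n ∫ φ dW_n(z)`, `W_0 = R_{a+Nε}`,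
  `W_{n+1} = R_{a+Nε} ∘ₖ (Q ∘ₖ W_n)`, `R_r = LangevinChainSemigroup.resolventKernel` the flip-free resolvent kernel
  (`JumpPerturbation.lintegral_expMeasure_lintegral_U` summed over `n`) — i.e. `∫₀^∞ a e^{-at} V_t dt` is the Neumann
  series `a (a + Nε − L − NεQ)⁻¹ = ∑_n (a/(a+Nε))(Nε/(a+Nε))^n (R Q)^n R`, now for UNBOUNDED nonnegative observables.

Registered sub-goal: `helper_flipSemigroupGibbs`. No definitions. References: Bernardin–Olla 2011 §2.1;
Ethier–Kurtz 1986, Ch. 1 §7, Ch. 4 §10; folklore.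
-/

noncomputable section

namespace Summit.AtomisticToContinuum.FouriersLaw.Theorems.VanishingNoiseBound

open MeasureTheory ProbabilityTheory Filter Topology Set Function
open scoped NNReal ENNReal ContDiff
open Literature.MathematicalPhysics.KineticTheory.HeatConduction
open Literature.MathematicalPhysics.KineticTheory
open Summit.AtomisticToContinuum.FouriersLaw.Theorems.SubdiffusiveBondHeat (pinnedChain_gibbsMeasure_bind_transitionKernel)

section Flip

variable {N : ℕ} {ω₂ lam β γ : ℝ}

/-- The Gibbs measure is invariant under the uniform single-site flip kernel `Q = flipKernel N`, Lebesgue form: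
`∫ μ_T(dx) ∫ f dQ(x, ·) = ∫ f dμ_T` (`H` is even in each momentum). [folklore] -/
theorem lintegral_flipKernel_gibbsMeasure (P : OscillatorChain) (hN : 0 < N) (T : ℝ) {f : PhaseSpace N → ℝ≥0∞}
    (hf : Measurable f) :
    ∫⁻ x, ∫⁻ z, f z ∂(flipKernel N x) ∂(P.gibbsMeasure N T) = ∫⁻ z, f z ∂(P.gibbsMeasure N T) := by
  simp_rw [lintegral_flipKernel hN]
  have hms : Measurable fun x => ∑ i : Fin N, f (momentumFlip i x) :=
    Finset.measurable_sum _ fun i _ => hf.comp (measurable_momentumFlip i)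
  rw [lintegral_const_mul _ hms, lintegral_finsetSum _ (f := fun (i : Fin N) (x : PhaseSpace N) =>
    f (momentumFlip i x)) fun i _ => hf.comp (measurable_momentumFlip i)]
  have h : ∀ i : Fin N, ∫⁻ x, f (momentumFlip i x) ∂(P.gibbsMeasure N T) = ∫⁻ z, f z ∂(P.gibbsMeasure N T) :=
    fun i => (P.measurePreserving_momentumFlip_gibbsMeasure N T i).lintegral_comp hf
  simp_rw [h]
  rw [Finset.sum_const, Finset.card_univ, Fintype.card_fin, nsmul_eq_mul, ← mul_assoc,
    ENNReal.inv_mul_cancel (Nat.cast_ne_zero.2 hN.ne') (ENNReal.natCast_ne_top _), one_mul]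

/-- The Gibbs measure at `T_L = T_R = T` is invariant under the time-extended flip-free kernel, Lebesgue form:
`∫ μ_T(dx) ∫ f dP_{t⁺}(x, ·) = ∫ f dμ_T` (`pinnedChain_gibbsMeasure_bind_transitionKernel`). [folklore] -/
theorem lintegral_timeKernel_gibbsMeasure (hω : 0 < ω₂) (hl : 0 ≤ lam) (hβ : 0 ≤ β) (hγ : 0 ≤ γ) (hN : 0 < N)
    {T : ℝ} (hT : 0 < T) (t : ℝ) {f : PhaseSpace N → ℝ≥0∞} (hf : Measurable f) :
    ∫⁻ x, ∫⁻ z, f z ∂((pinnedChainSemigroup hω hl hβ hγ hN hT.le hT.le).timeKernel (t, x))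
        ∂((pinnedChain ω₂ lam β γ).gibbsMeasure N T) =
      ∫⁻ z, f z ∂((pinnedChain ω₂ lam β γ).gibbsMeasure N T) := by
  have h := pinnedChain_gibbsMeasure_bind_transitionKernel hω hl hβ hγ hN hT t.toNNReal
  have hK : ∀ x, (pinnedChainSemigroup hω hl hβ hγ hN hT.le hT.le).timeKernel (t, x) =
      (pinnedChain ω₂ lam β γ).transitionKernel N T T t.toNNReal x := fun x => rfl
  simp_rw [hK]
  conv_rhs => rw [← h]
  rw [Measure.lintegral_bind (Kernel.aemeasurable _) hf.aemeasurable]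

/-- **The flip semigroup of the pinned anharmonic chain at equilibrium.** For `pinnedChain ω₂ lam β γ`
(`ω₂ > 0`, `lam, β, γ ≥ 0`), `N ≥ 1` sites, both baths at `T > 0` and a flip rate `ε > 0`, there is a family of
MARKOV kernels `V_t` (`t ≥ 0`) — the transition semigroup of `L + εS`, the Dyson–Phillips perturbation of the
flip-free semigroup `pinnedChainSemigroup` by `Q = flipKernel N` at rate `Nε` — with, besides the six properties of
`exists_flipSemigroup` ((1) `V_0 = id`; (2) Chapman–Kolmogorov; (3) joint measurability; (4) domination
`V_t ≥ e^{-Nεt} P_t`; (5) the resolvent identity `∫ Exp_a(dt) V_t (L + εS) f = a (∫ Exp_a(dt) V_t f − f)` on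
`C_c^∞`), the two equilibrium clauses:
(6) INVARIANCE of the Gibbs measure, `μ_T V_t = μ_T` (`(gibbsMeasure N T).bind (V t) = gibbsMeasure N T`);
(7) the LAPLACE–NEUMANN IDENTITY: for `a > 0`, every sequence of kernels `W` with `W_0 = R_{a+Nε}`,
`W_{n+1} = R_{a+Nε} ∘ₖ (Q ∘ₖ W_n)` (`R_r` the flip-free resolvent kernel), every measurable `φ ≥ 0` and every `z`,
`∫ Exp_a(dt) ∫ φ dV_t(z, ·) = ∑_n (a/(a+Nε))(Nε/(a+Nε))^n ∫ φ dW_n(z)`.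
Proof: that of `exists_flipSemigroup` (verbatim), plus `JumpPerturbation.bind_V_of_invariant` for (6) and the
summed `JumpPerturbation.lintegral_expMeasure_lintegral_U` for (7).
[Bernardin–Olla 2011, §2.1; Ethier–Kurtz 1986, Ch. 1 §7, Ch. 4 §10; folklore] -/
theorem exists_flipSemigroup_gibbs (hω : 0 < ω₂) (hl : 0 ≤ lam) (hβ : 0 ≤ β) (hγ : 0 ≤ γ) (hN : 0 < N)
    {T : ℝ} (hT : 0 < T) {ε : ℝ} (hε : 0 < ε) :
    ∃ V : ℝ≥0 → Kernel (PhaseSpace N) (PhaseSpace N),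
      (∀ t, IsMarkovKernel (V t)) ∧ V 0 = Kernel.id ∧ (∀ s t, V (s + t) = V t ∘ₖ V s) ∧
      (Measurable fun p : ℝ≥0 × PhaseSpace N => V p.1 p.2) ∧
      (∀ (t : ℝ≥0) (z : PhaseSpace N), ENNReal.ofReal (Real.exp (-(N * ε * t))) •
        (pinnedChain ω₂ lam β γ).transitionKernel N T T t z ≤ V t z) ∧
      (∀ a : ℝ, 0 < a → ∀ f : PhaseSpace N → ℝ, ContDiff ℝ ∞ f → HasCompactSupport f →
        ∀ z : PhaseSpace N,
          ∫ t, (∫ y, (pinnedChain ω₂ lam β γ).flipGenerator N T T ε f y ∂(V t.toNNReal z))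
              ∂(expMeasure a) =
            a * ((∫ t, (∫ y, f y ∂(V t.toNNReal z)) ∂(expMeasure a)) - f z)) ∧
      (∀ t, ((pinnedChain ω₂ lam β γ).gibbsMeasure N T).bind (V t) =
        (pinnedChain ω₂ lam β γ).gibbsMeasure N T) ∧
      (∀ a : ℝ, 0 < a → ∀ W : ℕ → Kernel (PhaseSpace N) (PhaseSpace N),
        W 0 = (pinnedChainSemigroup hω hl hβ hγ hN hT.le hT.le).resolventKernel (a + N * ε) →
        (∀ n, W (n + 1) = (pinnedChainSemigroup hω hl hβ hγ hN hT.le hT.le).resolventKernel (a + N * ε) ∘ₖ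
          (flipKernel N ∘ₖ W n)) →
        ∀ φ : PhaseSpace N → ℝ≥0∞, Measurable φ → ∀ z : PhaseSpace N,
          ∫⁻ t, ∫⁻ y, φ y ∂(V t.toNNReal z) ∂(expMeasure a) =
            ∑' n, ENNReal.ofReal (a / (a + N * ε) * (N * ε / (a + N * ε)) ^ n) * ∫⁻ y, φ y ∂(W n z)) := by
  -- adapted from `exists_flipSemigroup` (…VanishingNoiseBoundFlipSemigroup): same construction, two clauses more
  set P := pinnedChain ω₂ lam β γ with hPdef
  set S := pinnedChainSemigroup hω hl hβ hγ hN hT.le hT.le with hSdef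
  set K : Kernel (ℝ × PhaseSpace N) (PhaseSpace N) := S.timeKernel with hKdef
  set Q : Kernel (PhaseSpace N) (PhaseSpace N) := flipKernel N with hQdef
  set μ : Measure (PhaseSpace N) := P.gibbsMeasure N T with hμdef
  haveI : IsProbabilityMeasure μ := pinnedChain_isProbabilityMeasure_gibbsMeasure hω hl hβ γ N hT
  have hr : 0 < (N : ℝ) * ε := by positivity
  haveI := isProbabilityMeasure_expMeasure hr
  have hKadd : ∀ s t : ℝ, 0 ≤ s → 0 ≤ t → ∀ (x : PhaseSpace N) (f : PhaseSpace N → ℝ≥0∞), Measurable f →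
      ∫⁻ z, f z ∂(K (s + t, x)) = ∫⁻ y, ∫⁻ z, f z ∂(K (t, y)) ∂(K (s, x)) :=
    fun s t hs ht x f hf => lintegral_timeKernel_add S hs ht x hf
  obtain ⟨U, hUfin, hU0, hUsucc⟩ := JumpPerturbation.exists_dysonPhillips K Q hr
  haveI := hUfin
  -- the perturbed kernels `V_t = ∑_n U_n(t)`
  obtain ⟨V, hV⟩ : ∃ V : ℝ≥0 → Kernel (PhaseSpace N) (PhaseSpace N),
      ∀ (t : ℝ≥0) (x : PhaseSpace N), V t x = Measure.sum fun n => U n ((t : ℝ), x) :=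
    ⟨fun t => Kernel.sum fun n => (U n).comap (fun x => ((t : ℝ), x)) measurable_prodMk_left,
      fun t x => by simp only [Kernel.sum_apply, Kernel.comap_apply]⟩
  -- no jump can have happened at time `0`
  have hUsucc0 : ∀ n x, U (n + 1) (0, x) = 0 := by
    intro n x
    have hFm : Measurable fun q : ℝ × PhaseSpace N => ∫⁻ y', ∫⁻ z, (1 : ℝ≥0∞) ∂(K (q.1, y')) ∂(Q q.2) :=
      JumpPerturbation.measurable_jumpObs K Q measurable_const
    have hm : Measurable fun s : ℝ =>
        ∫⁻ y, ∫⁻ y', ∫⁻ z, (1 : ℝ≥0∞) ∂(K (s, y')) ∂(Q y) ∂(U n (0 - s, x)) :=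
      (JumpPerturbation.measurable_lintegral_shift (U n) 0 hFm).comp (measurable_id.prodMk measurable_const)
    have hmass : U (n + 1) (0, x) univ = 0 := by
      rw [← lintegral_one, hUsucc n ((0 : ℝ), x) (fun _ => 1) measurable_const]
      dsimp only
      rw [JumpPerturbation.lintegral_expMeasure_indicator' _ measurableSet_Iio hm, Iio_inter_Ioi, Ioo_self]
      simp
    exact Measure.measure_univ_eq_zero.mp hmass
  have hU00 : ∀ x, U 0 (0, x) = Measure.dirac x := by
    intro x
    rw [hU0 ((0 : ℝ), x) le_rfl]
    simp [K, LangevinChainSemigroup.timeKernel_apply]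
  -- joint measurability: `(t, x) ↦ V_t(x, ·)` is itself a (sum) kernel
  obtain ⟨Vj, hVj⟩ : ∃ Vj : Kernel (ℝ≥0 × PhaseSpace N) (PhaseSpace N),
      ∀ p : ℝ≥0 × PhaseSpace N, Vj p = V p.1 p.2 :=
    ⟨Kernel.sum fun n => (U n).comap (fun p : ℝ≥0 × PhaseSpace N => ((p.1 : ℝ), p.2)) (by fun_prop),
      fun p => by rw [hV]; simp only [Kernel.sum_apply, Kernel.comap_apply]⟩
  have hmeas : Measurable fun p : ℝ≥0 × PhaseSpace N => V p.1 p.2 := by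
    have : (fun p : ℝ≥0 × PhaseSpace N => V p.1 p.2) = ⇑Vj := funext fun p => (hVj p).symm
    rw [this]
    exact Vj.measurable
  -- (6) invariance of the Gibbs measure
  have hinv : ∀ t, μ.bind (V t) = μ := fun t =>
    JumpPerturbation.bind_V_of_invariant K Q hr U hU0 hUsucc V hV
      (fun s f hf => lintegral_timeKernel_gibbsMeasure hω hl hβ hγ hN hT s hf)
      (fun f hf => lintegral_flipKernel_gibbsMeasure P hN T hf) t
  -- (7) the Laplace–Neumann identity
  have hVt : ∀ (z : PhaseSpace N) (t : ℝ), 0 < t → V t.toNNReal z = Measure.sum fun n => U n (t, z) := by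
    intro z t ht
    rw [hV, Real.coe_toNNReal t ht.le]
  have hLapN : ∀ a : ℝ, 0 < a → ∀ W : ℕ → Kernel (PhaseSpace N) (PhaseSpace N),
      W 0 = S.resolventKernel (a + N * ε) →
      (∀ n, W (n + 1) = S.resolventKernel (a + N * ε) ∘ₖ (Q ∘ₖ W n)) →
      ∀ φ : PhaseSpace N → ℝ≥0∞, Measurable φ → ∀ z : PhaseSpace N,
        ∫⁻ t, ∫⁻ y, φ y ∂(V t.toNNReal z) ∂(expMeasure a) =
          ∑' n, ENNReal.ofReal (a / (a + N * ε) * (N * ε / (a + N * ε)) ^ n) * ∫⁻ y, φ y ∂(W n z) := by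
    intro a ha W hW0 hWsucc φ hφ z
    haveI := isProbabilityMeasure_expMeasure ha
    have hR : S.resolventKernel (a + N * ε) =
        K ∘ₖ (Kernel.const (PhaseSpace N) (expMeasure (a + N * ε)) ×ₖ Kernel.id) := rfl
    haveI hWm : ∀ n, IsMarkovKernel (W n) :=
      JumpPerturbation.isMarkovKernel_W K Q hr ha (S.resolventKernel (a + N * ε)) hR W hW0 hWsucc
    haveI hWs : ∀ n, IsSFiniteKernel (W n) := fun n => by infer_instance
    have hm1 : ∀ n, Measurable fun t : ℝ => ∫⁻ y, φ y ∂(U n (t, z)) := fun n =>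
      JumpPerturbation.measurable_lintegral_time (U n) z hφ
    -- measurability in `t` through kernels in the time variable
    have hm2 : Measurable fun t : ℝ => ∫⁻ y, φ y ∂(V t.toNNReal z) := by
      have h := hφ.lintegral_kernel (κ := Vj.comap (fun t : ℝ => (t.toNNReal, z)) (by fun_prop))
      simpa only [Kernel.comap_apply, hVj] using h
    obtain ⟨Uz, hUz⟩ : ∃ Uz : Kernel ℝ (PhaseSpace N),
        ∀ t, ∫⁻ y, φ y ∂(Uz t) = ∑' n, ∫⁻ y, φ y ∂(U n (t, z)) :=
      ⟨Kernel.sum fun n => (U n).comap (fun t : ℝ => (t, z)) measurable_prodMk_right,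
        fun t => by simp only [Kernel.sum_apply, Kernel.comap_apply, lintegral_sum_measure]⟩
    have hm3 : Measurable fun t : ℝ => ∑' n, ∫⁻ y, φ y ∂(U n (t, z)) := by
      have h := hφ.lintegral_kernel (κ := Uz)
      simpa only [hUz] using h
    rw [JumpPerturbation.lintegral_expMeasure a hm2]
    have hpt : ∀ t ∈ Ioi (0:ℝ), ENNReal.ofReal (a * Real.exp (-(a * t))) * ∫⁻ y, φ y ∂(V t.toNNReal z) =
        ENNReal.ofReal (a * Real.exp (-(a * t))) * ∑' n, ∫⁻ y, φ y ∂(U n (t, z)) := by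
      intro t ht
      rw [hVt z t ht, lintegral_sum_measure]
    rw [setLIntegral_congr_fun measurableSet_Ioi hpt,
      ← JumpPerturbation.lintegral_expMeasure a hm3,
      lintegral_tsum fun n => (hm1 n).aemeasurable]
    exact tsum_congr fun n => JumpPerturbation.lintegral_expMeasure_lintegral_U K Q hr U hU0 hUsucc ha
      (S.resolventKernel (a + N * ε)) hR W hW0 hWsucc n z hφ
  refine ⟨V, fun t => JumpPerturbation.isMarkovKernel_V K Q hr U hU0 hUsucc V hV t, ?_,
    fun s t => JumpPerturbation.V_add K Q hr hKadd U hU0 hUsucc V hV s t, hmeas, ?_, ?_, hinv, hLapN⟩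
  · -- (1) `V_0 = id`
    refine Kernel.ext fun x => ?_
    rw [hV, Kernel.id_apply, NNReal.coe_zero]
    refine Measure.ext fun s hs => ?_
    rw [Measure.sum_apply _ hs, tsum_eq_single 0 fun n hn => ?_, hU00 x]
    obtain ⟨m, rfl⟩ := Nat.exists_eq_succ_of_ne_zero hn
    rw [hUsucc0 m x]
    rfl
  · -- (4) domination by the flip-free evolution
    intro t z
    have h := JumpPerturbation.smul_kernel_le_V K U hU0 V hV t z
    have hK : K ((t : ℝ), z) = P.transitionKernel N T T t z := by
      show S.kernel (t : ℝ).toNNReal z = _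
      rw [Real.toNNReal_coe]
      rfl
    rwa [hK] at h
  · -- (5) the resolvent identity
    intro a ha f hf hfc z
    have hb : 0 < a + N * ε := by linarith
    haveI := isProbabilityMeasure_expMeasure ha
    haveI := isProbabilityMeasure_expMeasure hb
    -- the Neumann series of resolvent kernels
    set R : Kernel (PhaseSpace N) (PhaseSpace N) := S.resolventKernel (a + N * ε) with hRdef
    have hR : R = K ∘ₖ (Kernel.const (PhaseSpace N) (expMeasure (a + N * ε)) ×ₖ Kernel.id) := rfl
    obtain ⟨W, hW0, hWsucc⟩ : ∃ W : ℕ → Kernel (PhaseSpace N) (PhaseSpace N),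
        W 0 = R ∧ ∀ n, W (n + 1) = R ∘ₖ (Q ∘ₖ W n) :=
      ⟨fun n => Nat.rec R (fun _ w => R ∘ₖ (Q ∘ₖ w)) n, rfl, fun n => rfl⟩
    haveI hWm : ∀ n, IsMarkovKernel (W n) := JumpPerturbation.isMarkovKernel_W K Q hr ha R hR W hW0 hWsucc
    haveI hWs : ∀ n, IsSFiniteKernel (W n) := fun n => by infer_instance
    obtain ⟨RQ, hRQ⟩ : ∃ RQ : Kernel (PhaseSpace N) (PhaseSpace N), ∀ x, RQ x = Measure.sum fun n =>
        ENNReal.ofReal (a / (a + N * ε) * (N * ε / (a + N * ε)) ^ n) • W n x := by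
      refine ⟨Kernel.sum fun n => Kernel.withDensity (W n)
        (fun (_ : PhaseSpace N) (_ : PhaseSpace N) =>
          ENNReal.ofReal (a / (a + N * ε) * (N * ε / (a + N * ε)) ^ n)), fun x => ?_⟩
      simp only [Kernel.sum_apply]
      congr 1
      funext n
      rw [Kernel.withDensity_apply (W n)
          (f := fun (_ : PhaseSpace N) (_ : PhaseSpace N) =>
            ENNReal.ofReal (a / (a + N * ε) * (N * ε / (a + N * ε)) ^ n)) measurable_const,
        withDensity_const]
    haveI := JumpPerturbation.isMarkovKernel_RQ K Q hr ha R hR W hW0 hWsucc RQ hRQ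
    -- (i) the Laplace transform of `V` is `RQ`, as measures (clause (7))
    have hlap : ∀ φ : PhaseSpace N → ℝ≥0∞, Measurable φ →
        ∫⁻ t, ∫⁻ y, φ y ∂(V t.toNNReal z) ∂(expMeasure a) = ∫⁻ y, φ y ∂(RQ z) := by
      intro φ hφ
      rw [hLapN a ha W hW0 hWsucc φ hφ z, hRQ z, lintegral_sum_measure]
      refine tsum_congr fun n => ?_
      rw [lintegral_smul_measure, smul_eq_mul]
    -- (ii) hence `∫ Exp_a(dt) ∫ h dV_t(z,·) = ∫ h dRQ(z)` for bounded measurable `h`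
    obtain ⟨κ, hκ⟩ : ∃ κ : Kernel ℝ (PhaseSpace N), ∀ t, κ t = V t.toNNReal z :=
      ⟨Vj.comap (fun t : ℝ => (t.toNNReal, z)) (by fun_prop), fun t => by
        simp only [Kernel.comap_apply, hVj]⟩
    have hbind : (κ ∘ₘ expMeasure a) = RQ z := by
      refine Measure.ext_of_lintegral _ fun φ hφ => ?_
      rw [Measure.lintegral_bind (Kernel.aemeasurable κ) hφ.aemeasurable]
      simp_rw [hκ]
      exact hlap φ hφ
    have htransfer : ∀ h : PhaseSpace N → ℝ, Measurable h → ∀ C : ℝ, (∀ y, ‖h y‖ ≤ C) →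
        ∫ t, (∫ y, h y ∂(V t.toNNReal z)) ∂(expMeasure a) = ∫ y, h y ∂(RQ z) := by
      intro h hm C hC
      have hint : Integrable h ((κ ∘ₖ Kernel.const Unit (expMeasure a)) ()) := by
        rw [← Measure.comp_eq_comp_const_apply, hbind]
        exact JumpPerturbation.integrable_of_norm_le hm hC
      calc ∫ t, (∫ y, h y ∂(V t.toNNReal z)) ∂(expMeasure a)
          = ∫ t, ∫ y, h y ∂(κ t) ∂(Kernel.const Unit (expMeasure a) ()) := by
            rw [Kernel.const_apply]; simp_rw [hκ]
        _ = ∫ y, h y ∂((κ ∘ₖ Kernel.const Unit (expMeasure a)) ()) := (Kernel.integral_comp hint).symm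
        _ = ∫ y, h y ∂(RQ z) := by rw [← Measure.comp_eq_comp_const_apply, hbind]
    -- (iii) the abstract resolvent identity for the Dynkin pair `(f, L f)`
    have hf2 : ContDiff ℝ 2 f := hf.of_le (by norm_cast)
    have hgc : Continuous (P.generator N T T f) :=
      P.continuous_generator (pinnedChain_contDiff_U ω₂ lam β γ) (pinnedChain_contDiff_V ω₂ lam β γ) N T T hf2
    obtain ⟨Cg, hCg⟩ := P.exists_bound_generator (pinnedChain_contDiff_U ω₂ lam β γ)
      (pinnedChain_contDiff_V ω₂ lam β γ) N T T hf2 hfc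
    obtain ⟨Cf, hCf⟩ : ∃ C, ∀ x, ‖f x‖ ≤ C := hf.continuous.bounded_above_of_compact_support hfc
    have hres := JumpPerturbation.integral_RQ_eq_of_dynkin K Q hr ha R hR W hW0 hWsucc RQ hRQ z
      hf.continuous.measurable hgc.measurable hCf hCg
      (fun t ht y => timeKernel_dynkin S hf hfc ht y)
    -- (iv) identify the generator and transfer back to `V`
    have hgen : (fun y => P.generator N T T f y + N * ε * ((∫ x, f x ∂(Q y)) - f y)) =
        P.flipGenerator N T T ε f := funext fun y => generator_add_flipKernel P hN T T ε f y
    rw [hgen] at hres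
    have hLc : Continuous (P.flipGenerator N T T ε f) :=
      continuous_flipGenerator P (pinnedChain_contDiff_U ω₂ lam β γ) (pinnedChain_contDiff_V ω₂ lam β γ)
        T T ε hf2
    obtain ⟨CL, hCL⟩ := exists_bound_flipGenerator P (pinnedChain_contDiff_U ω₂ lam β γ)
      (pinnedChain_contDiff_V ω₂ lam β γ) T T ε hf2 hfc
    rw [htransfer _ hLc.measurable CL hCL, htransfer _ hf.continuous.measurable Cf hCf]
    exact hres

/-- **Registered sub-goal `helper_flipSemigroupGibbs`** of stmt-AtomisticToContinuum-11977 (brick for the T1 half of stub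
`stub_timeProfileMatching`, line `abel-storage-decay`): the equilibrium clauses (6) (Gibbs invariance) and (7)
(Laplace–Neumann identity) of `exists_flipSemigroup_gibbs` together with the Markov property and joint measurability,
fully quantified and notation-free. [folklore] -/
theorem helper_flipSemigroupGibbs : ∀ (ω₂ lam β γ : ℝ) (hω : 0 < ω₂) (hl : 0 ≤ lam) (hβ : 0 ≤ β) (hγ : 0 ≤ γ) (N : ℕ) (hN : 0 < N) (T : ℝ) (hT : 0 < T) (ε : ℝ), 0 < ε → ∃ V : NNReal → ProbabilityTheory.Kernel (Literature.MathematicalPhysics.KineticTheory.HeatConduction.PhaseSpace N) (Literature.MathematicalPhysics.KineticTheory.HeatConduction.PhaseSpace N), (∀ t, ProbabilityTheory.IsMarkovKernel (V t)) ∧ (Measurable fun p : NNReal × Literature.MathematicalPhysics.KineticTheory.HeatConduction.PhaseSpace N => V p.1 p.2) ∧ (∀ t : NNReal, ((Literature.MathematicalPhysics.KineticTheory.HeatConduction.pinnedChain ω₂ lam β γ).gibbsMeasure N T).bind (V t) = (Literature.MathematicalPhysics.KineticTheory.HeatConduction.pinnedChain ω₂ lam β γ).gibbsMeasure N T) ∧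 (∀ a : ℝ, 0 < a → ∀ W : ℕ → ProbabilityTheory.Kernel (Literature.MathematicalPhysics.KineticTheory.HeatConduction.PhaseSpace N) (Literature.MathematicalPhysics.KineticTheory.HeatConduction.PhaseSpace N), W 0 = (Literature.MathematicalPhysics.KineticTheory.HeatConduction.pinnedChainSemigroup hω hl hβ hγ hN (le_of_lt hT) (le_of_lt hT)).resolventKernel (a + (N : ℝ) * ε) → (∀ n, W (n + 1) = ProbabilityTheory.Kernel.comp ((Literature.MathematicalPhysics.KineticTheory.HeatConduction.pinnedChainSemigroup hω hl hβ hγ hN (le_of_lt hT) (le_of_lt hT)).resolventKernel (a + (N : ℝ) * ε)) (ProbabilityTheory.Kernel.comp (Literature.MathematicalPhysics.KineticTheory.HeatConduction.flipKernel N) (W n))) → ∀ φ : Literature.MathematicalPhysics.KineticTheory.HeatConduction.PhaseSpace N → ENNReal, Measurable φ → ∀ z : Literature.MathematicalPhysics.KineticTheory.HeatConduction.PhaseSpace N, MeasureTheory.lintegral (ProbabilityTheory.expMeasure a) (fun t => MeasureTheory.lintegral (V t.toNNReal z) (fun y => φ y)) = ∑' n, ENNReal.ofReal (a / (a + (N :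 ℝ) * ε) * ((N : ℝ) * ε / (a + (N : ℝ) * ε)) ^ n) * MeasureTheory.lintegral (W n z) (fun y => φ y)) := by
  intro ω₂ lam β γ hω hl hβ hγ N hN T hT ε hε
  obtain ⟨V, hV1, -, -, hV4, -, -, hV7, hV8⟩ := exists_flipSemigroup_gibbs hω hl hβ hγ hN hT hε
  exact ⟨V, hV1, hV4, hV7, hV8⟩

end Flip

end Summit.AtomisticToContinuum.FouriersLaw.Theorems.VanishingNoiseBound

end
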